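import Mathlib
import HarnessLib
import Literature.Probability.LatticeModels.IsingThermodynamics

/-!
# Helpers (I) for the stub `stub_pointwiseUpgrade` of line `self-energy-pick-inversion`
(crux `PrecisionLaplacian.DirectCorrelationStableTail`, item stmt-CriticalPhenomena-4799)

Elementary lattice / Euclidean-norm facts used by the soft-analysis upgrade
"radial asymptotics + regularity at scale + convergence of the tail functionals ⟹ stable tail"
for a function `a : ℤ³ → ℝ`:
* the Euclidean norm `√(∑ j, v j ^ 2)` on `Fin 3 → ℝ` versus Mathlib's sup norm `‖v‖`
  (`√(∑ v_j²) = ‖toLp 2 v‖`, `‖v‖ ≤ √(∑ v_j²) ≤ 2‖v‖`, rounding error of the coordinatewise floor);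
* finiteness of Euclidean balls of `Site 3 = ℤ³`, hence `√(∑ x_j²) → ∞` along the cofinite filter, and
  finiteness of the lattice support of a rescaled compactly supported function;
* the lattice RIEMANN-SUM LEMMA `n⁻³ ∑_{y ∈ ℤ³} F (y / n) → ∫ F` for `F` continuous with compact support
  (a repackaging of Mathlib's `tendsto_tsum_div_pow_atTop_integral`);
* compactness of the Euclidean unit sphere `{u | ∑ u_i² = 1}` of `Fin 3 → ℝ`.

No definitions are introduced; all statements are folklore.
-/

noncomputable section

namespace Summit.CriticalPhenomena.Ising3DConformalLimit.Cruxes.DirectCorrelationStableTail.SelfEnergyPickInversion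

open MeasureTheory Filter Topology
open scoped BigOperators Pointwise
open Literature.Probability.LatticeModels

/-! ### The Euclidean norm `√(∑ j, v j ^ 2)` on `Fin 3 → ℝ` -/

/-- `√(∑ v_j²)` is the norm of `v` viewed in `EuclideanSpace ℝ (Fin 3)`. [folklore] -/
theorem sqrt_sum_sq_eq_norm (v : Fin 3 → ℝ) :
    √(∑ j, v j ^ 2) = ‖(WithLp.toLp 2 v : EuclideanSpace ℝ (Fin 3))‖ := by
  rw [EuclideanSpace.norm_eq]
  simp [Real.norm_eq_abs, sq_abs]

/-- Each coordinate is bounded by the Euclidean norm. [folklore] -/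
theorem abs_apply_le_sqrt_sum_sq (v : Fin 3 → ℝ) (j : Fin 3) : |v j| ≤ √(∑ i, v i ^ 2) :=
  Real.abs_le_sqrt
    (Finset.single_le_sum (f := fun i => v i ^ 2) (fun i _ => sq_nonneg (v i)) (Finset.mem_univ j))

/-- The sup norm is bounded by the Euclidean norm. [folklore] -/
theorem norm_le_sqrt_sum_sq (v : Fin 3 → ℝ) : ‖v‖ ≤ √(∑ i, v i ^ 2) :=
  (pi_norm_le_iff_of_nonneg (Real.sqrt_nonneg _)).2 fun j => by
    rw [Real.norm_eq_abs]
    exact abs_apply_le_sqrt_sum_sq v j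

/-- The Euclidean norm on `ℝ³` is at most twice the sup norm (`√3 ≤ 2`). [folklore] -/
theorem sqrt_sum_sq_le_two_mul_norm (v : Fin 3 → ℝ) : √(∑ i, v i ^ 2) ≤ 2 * ‖v‖ := by
  have h : ∀ i, v i ^ 2 ≤ ‖v‖ ^ 2 := fun i => by
    rw [← sq_abs]
    have hi : |v i| ≤ ‖v‖ := by simpa [Real.norm_eq_abs] using norm_le_pi_norm v i
    exact pow_le_pow_left₀ (abs_nonneg _) hi 2
  have hs : ∑ i, v i ^ 2 ≤ (2 * ‖v‖) ^ 2 :=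
    calc ∑ i, v i ^ 2 ≤ ∑ _i : Fin 3, ‖v‖ ^ 2 := Finset.sum_le_sum fun i _ => h i
      _ = 3 * ‖v‖ ^ 2 := by simp
      _ ≤ (2 * ‖v‖) ^ 2 := by nlinarith [norm_nonneg v]
  calc √(∑ i, v i ^ 2) ≤ √((2 * ‖v‖) ^ 2) := Real.sqrt_le_sqrt hs
    _ = 2 * ‖v‖ := Real.sqrt_sq (by positivity)

/-- A non-zero lattice point has Euclidean norm at least `1`. [folklore] -/
theorem one_le_sqrt_sum_sq (x : Site 3) (hx : x ≠ 0) : 1 ≤ √(∑ j, ((x j : ℝ)) ^ 2) := by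
  obtain ⟨j, hj⟩ : ∃ j, x j ≠ 0 := by
    by_contra h
    push Not at h
    exact hx (funext h)
  have h1 : (1 : ℝ) ≤ ((x j : ℝ)) ^ 2 := by
    have habs : (1 : ℝ) ≤ |(x j : ℝ)| := by exact_mod_cast Int.one_le_abs hj
    nlinarith [abs_nonneg ((x j : ℝ)), sq_abs ((x j : ℝ))]
  refine (Real.le_sqrt' one_pos).2 ?_
  rw [one_pow]
  exact h1.trans (Finset.single_le_sum (f := fun i => ((x i : ℝ)) ^ 2) (fun i _ => sq_nonneg _)
    (Finset.mem_univ j))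

/-- Rounding error of the coordinatewise floor: `|⌊w⌋ - w|₂ ≤ 2`. [folklore] -/
theorem sqrt_sum_sq_floor_sub_le (w : Fin 3 → ℝ) : √(∑ j, ((⌊w j⌋ : ℝ) - w j) ^ 2) ≤ 2 := by
  refine (sqrt_sum_sq_le_two_mul_norm (fun j => (⌊w j⌋ : ℝ) - w j)).trans ?_
  have : ‖(fun j => (⌊w j⌋ : ℝ) - w j)‖ ≤ 1 :=
    (pi_norm_le_iff_of_nonneg zero_le_one).2 fun j => by
      rw [Real.norm_eq_abs, abs_le]
      constructor <;> linarith [Int.floor_le (w j), Int.lt_floor_add_one (w j)]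
  linarith

/-- The coordinatewise floor moves a point by at most `1` in sup norm. [folklore] -/
theorem norm_floor_sub_le (w : Fin 3 → ℝ) : ‖(fun j => (⌊w j⌋ : ℝ) - w j)‖ ≤ 1 :=
  (pi_norm_le_iff_of_nonneg zero_le_one).2 fun j => by
    rw [Real.norm_eq_abs, abs_le]
    constructor <;> linarith [Int.floor_le (w j), Int.lt_floor_add_one (w j)]

/-- Symmetry of the Euclidean distance. [folklore] -/
theorem sqrt_sum_sq_sub_comm (p q : Fin 3 → ℝ) :
    √(∑ j, (p j - q j) ^ 2) = √(∑ j, (q j - p j) ^ 2) := by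
  congr 1
  exact Finset.sum_congr rfl fun j _ => by ring

/-- Triangle inequality for the Euclidean distance through an intermediate point. [folklore] -/
theorem sqrt_sum_sq_sub_le_add (p q w : Fin 3 → ℝ) :
    √(∑ j, (p j - w j) ^ 2) ≤ √(∑ j, (p j - q j) ^ 2) + √(∑ j, (q j - w j) ^ 2) := by
  have e : ∀ a b : Fin 3 → ℝ, √(∑ j, (a j - b j) ^ 2) =
      ‖(WithLp.toLp 2 a : EuclideanSpace ℝ (Fin 3)) - WithLp.toLp 2 b‖ := fun a b => by
    rw [← WithLp.toLp_sub, ← sqrt_sum_sq_eq_norm]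
    rfl
  rw [e, e, e]
  exact norm_sub_le_norm_sub_add_norm_sub _ _ _

/-- `|p|₂ ≤ |q|₂ + |p - q|₂`. [folklore] -/
theorem sqrt_sum_sq_le_add_sub (p q : Fin 3 → ℝ) :
    √(∑ j, p j ^ 2) ≤ √(∑ j, q j ^ 2) + √(∑ j, (p j - q j) ^ 2) := by
  have e : √(∑ j, (p j - q j) ^ 2) =
      ‖(WithLp.toLp 2 p : EuclideanSpace ℝ (Fin 3)) - WithLp.toLp 2 q‖ := by
    rw [← WithLp.toLp_sub, ← sqrt_sum_sq_eq_norm]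
    rfl
  rw [e, sqrt_sum_sq_eq_norm, sqrt_sum_sq_eq_norm]
  exact norm_le_norm_add_norm_sub' _ _

/-- Scaling of the Euclidean norm. [folklore] -/
theorem sqrt_sum_sq_const_mul (c : ℝ) (v : Fin 3 → ℝ) :
    √(∑ j, (c * v j) ^ 2) = |c| * √(∑ j, v j ^ 2) := by
  simp_rw [mul_pow]
  rw [← Finset.mul_sum, Real.sqrt_mul (sq_nonneg c), Real.sqrt_sq_eq_abs]

/-- On the Euclidean unit sphere the Euclidean norm is `1`. [folklore] -/
theorem sqrt_sum_sq_eq_one {u : Fin 3 → ℝ} (hu : ∑ i, u i ^ 2 = 1) : √(∑ i, u i ^ 2) = 1 := by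
  rw [hu, Real.sqrt_one]

/-- A point of the Euclidean unit sphere has sup norm at least `1/2`. [folklore] -/
theorem half_le_norm_of_sphere {u : Fin 3 → ℝ} (hu : ∑ i, u i ^ 2 = 1) : 1 / 2 ≤ ‖u‖ := by
  have := sqrt_sum_sq_le_two_mul_norm u
  rw [sqrt_sum_sq_eq_one hu] at this
  linarith

/-- A point of the Euclidean unit sphere has sup norm at most `1`. [folklore] -/
theorem norm_le_one_of_sphere {u : Fin 3 → ℝ} (hu : ∑ i, u i ^ 2 = 1) : ‖u‖ ≤ 1 := by
  have := norm_le_sqrt_sum_sq u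
  rwa [sqrt_sum_sq_eq_one hu] at this

/-- Scaling: `|N u|₂ = N` on the unit sphere. [folklore] -/
theorem sqrt_sum_sq_smul_sphere {u : Fin 3 → ℝ} (hu : ∑ i, u i ^ 2 = 1) {t : ℝ} (ht : 0 ≤ t) :
    √(∑ i, (t * u i) ^ 2) = t := by
  have : ∑ i, (t * u i) ^ 2 = t ^ 2 := by
    simp_rw [mul_pow]
    rw [← Finset.mul_sum, hu, mul_one]
  rw [this, Real.sqrt_sq ht]

/-- The rounded point `⌊t u⌋` of a unit vector `u` has Euclidean norm at least `t - 2`. [folklore] -/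
theorem sub_two_le_sqrt_sum_sq_floor {u : Fin 3 → ℝ} (hu : ∑ i, u i ^ 2 = 1) {t : ℝ} (ht : 0 ≤ t) :
    t - 2 ≤ √(∑ j, ((⌊t * u j⌋ : ℝ)) ^ 2) := by
  have h1 : √(∑ j, (t * u j) ^ 2) ≤
      √(∑ j, ((⌊t * u j⌋ : ℝ)) ^ 2) + √(∑ j, (t * u j - (⌊t * u j⌋ : ℝ)) ^ 2) :=
    sqrt_sum_sq_le_add_sub _ _
  have h2 : √(∑ j, (t * u j - (⌊t * u j⌋ : ℝ)) ^ 2) ≤ 2 := by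
    rw [sqrt_sum_sq_sub_comm]
    exact sqrt_sum_sq_floor_sub_le (fun j => t * u j)
  rw [sqrt_sum_sq_smul_sphere hu ht] at h1
  linarith

/-- The Euclidean unit sphere of `Fin 3 → ℝ` is compact. [folklore] -/
theorem isCompact_sphere_set : IsCompact {u : Fin 3 → ℝ | ∑ i, u i ^ 2 = 1} := by
  refine Metric.isCompact_of_isClosed_isBounded (isClosed_eq (by fun_prop) continuous_const) ?_
  refine (Metric.isBounded_closedBall (x := (0 : Fin 3 → ℝ)) (r := 1)).subset fun u hu => ?_
  rw [Metric.mem_closedBall, dist_zero_right]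
  exact norm_le_one_of_sphere hu

/-! ### Finiteness of Euclidean balls in `ℤ³` -/

/-- A lattice point with coordinates bounded by `K` lies in the box `[-⌈K⌉, ⌈K⌉]^d`. [folklore] -/
theorem mem_box_of_abs_le {d : ℕ} (K : ℝ) (x : Fin d → ℤ) (hK : ∀ j, |(x j : ℝ)| ≤ K) :
    x ∈ Fintype.piFinset fun _ : Fin d => Finset.Icc (-⌈K⌉) ⌈K⌉ := by
  refine Fintype.mem_piFinset.2 fun j => Finset.mem_Icc.2 ?_
  have h := hK j
  rw [abs_le] at h
  constructor
  · have : ((-⌈K⌉ : ℤ) : ℝ) ≤ x j := by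
      push_cast
      linarith [Int.le_ceil K]
    exact_mod_cast this
  · have : ((x j : ℤ) : ℝ) ≤ ⌈K⌉ := h.2.trans (Int.le_ceil K)
    exact_mod_cast this

/-- Euclidean balls of `ℤ³` are finite. [folklore] -/
theorem finite_sqrt_sum_sq_le (R : ℝ) : {x : Site 3 | √(∑ j, ((x j : ℝ)) ^ 2) ≤ R}.Finite :=
  (Fintype.piFinset fun _ : Fin 3 => Finset.Icc (-⌈R⌉) ⌈R⌉).finite_toSet.subset fun x hx =>
    Finset.mem_coe.2 (mem_box_of_abs_le R x fun j =>
      (abs_apply_le_sqrt_sum_sq (fun j => (x j : ℝ)) j).trans hx)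

/-- The Euclidean norm tends to infinity along the cofinite filter of `ℤ³`. [folklore] -/
theorem tendsto_sqrt_sum_sq_cofinite :
    Tendsto (fun x : Site 3 => √(∑ j, ((x j : ℝ)) ^ 2)) cofinite atTop := by
  refine tendsto_atTop.2 fun R => Filter.eventually_cofinite.2 ((finite_sqrt_sum_sq_le R).subset ?_)
  intro x hx
  simp only [Set.mem_setOf_eq, not_le] at hx ⊢
  exact hx.le

/-- An eventually-cofinite property of lattice points holds outside a large Euclidean ball.
[folklore] -/
theorem exists_radius_of_eventually_cofinite {p : Site 3 → Prop} (hp : ∀ᶠ x in cofinite, p x) :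
    ∃ R : ℝ, ∀ x : Site 3, R ≤ √(∑ j, ((x j : ℝ)) ^ 2) → p x := by
  rw [Filter.eventually_cofinite] at hp
  obtain ⟨R, hR⟩ := (hp.image fun x : Site 3 => √(∑ j, ((x j : ℝ)) ^ 2)).bddAbove
  refine ⟨R + 1, fun x hx => ?_⟩
  by_contra hpx
  have := hR (Set.mem_image_of_mem _ hpx)
  linarith

/-- The lattice support of a rescaled compactly supported function is finite. [folklore] -/
theorem exists_finset_support_rescaled (f : (Fin 3 → ℝ) → ℝ) (hf : HasCompactSupport f) {N : ℕ}
    (hN : 0 < N) :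
    ∃ B : Finset (Site 3), ∀ y : Site 3, y ∉ B → f (fun j => (y j : ℝ) / N) = 0 := by
  obtain ⟨M, hM⟩ := isBounded_iff_forall_norm_le.1 hf.isCompact.isBounded
  refine ⟨Fintype.piFinset fun _ : Fin 3 => Finset.Icc (-⌈M * N⌉) ⌈M * N⌉, fun y hy => ?_⟩
  by_contra hne
  have hmem : (fun j => (y j : ℝ) / N) ∈ tsupport f :=
    subset_tsupport f (Function.mem_support.2 hne)
  have hnorm := hM _ hmem
  refine hy (mem_box_of_abs_le (M * N) y fun j => ?_)
  have hN' : (0 : ℝ) < N := by exact_mod_cast hN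
  have hj : |(y j : ℝ) / N| ≤ M := by
    have := norm_le_pi_norm (fun j => (y j : ℝ) / N) j
    rw [Real.norm_eq_abs] at this
    exact this.trans hnorm
  rwa [abs_div, abs_of_pos hN', div_le_iff₀ hN'] at hj

/-! ### Lattice Riemann sums -/

/-- **Lattice Riemann-sum lemma.** For `F : ℝ³ → ℝ` continuous with compact support,
`n⁻³ ∑_{y ∈ ℤ³} F (y / n) → ∫ F` as `n → ∞` in `ℕ` (from Mathlib's
`tendsto_tsum_div_pow_atTop_integral` on a large closed sup-ball, whose boundary sphere is
Lebesgue-null). [folklore] -/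
theorem tendsto_lattice_sum_div_cube (F : (Fin 3 → ℝ) → ℝ) (hF : Continuous F)
    (hFc : HasCompactSupport F) :
    Tendsto (fun n : ℕ => (∑' y : Site 3, F (fun j => (y j : ℝ) / n)) / (n : ℝ) ^ 3) atTop
      (𝓝 (∫ v, F v)) := by
  obtain ⟨M₀, hM₀⟩ := isBounded_iff_forall_norm_le.1 hFc.isCompact.isBounded
  set M : ℝ := max M₀ 1 with hMdef
  have hM : 0 < M := lt_of_lt_of_le one_pos (le_max_right _ _)
  set s : Set (Fin 3 → ℝ) := Metric.closedBall 0 M with hsdef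
  have hsupp : ∀ v, v ∉ s → F v = 0 := fun v hv => by
    by_contra hne
    exact hv (Metric.mem_closedBall.2 (by
      rw [dist_zero_right]
      exact (hM₀ v (subset_tsupport F (Function.mem_support.2 hne))).trans (le_max_left _ _)))
  have key := tendsto_tsum_div_pow_atTop_integral s F hF Metric.isBounded_closedBall
    Metric.isClosed_closedBall.measurableSet
    (by rw [frontier_closedBall 0 hM.ne']; exact Measure.addHaar_sphere volume 0 M)
  rw [setIntegral_eq_integral_of_forall_compl_eq_zero (fun v hv => hsupp v hv),
    Fintype.card_fin] at key
  refine key.congr' ?_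
  filter_upwards [eventually_ge_atTop 1] with n hn
  haveI : NeZero n := ⟨by omega⟩
  have hn0 : (n : ℝ) ≠ 0 := by exact_mod_cast (NeZero.ne n)
  congr 1
  rw [tsum_subtype]
  set g : Site 3 → (Fin 3 → ℝ) := fun y j => (y j : ℝ) / n with hg
  have hginj : Function.Injective g := by
    intro y y' hyy'
    funext j
    have := congr_fun hyy' j
    simp only [hg] at this
    exact_mod_cast (div_left_inj' hn0).1 this
  have hgmem : ∀ y, g y ∈ (n : ℝ)⁻¹ •
      ((Submodule.span ℤ (Set.range (Pi.basisFun ℝ (Fin 3))) : Submodule ℤ (Fin 3 → ℝ)) :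
        Set (Fin 3 → ℝ)) := by
    intro y
    rw [← Submodule.coe_pointwise_smul, SetLike.mem_coe,
      BoxIntegral.unitPartition.mem_smul_span_iff]
    intro i
    exact ⟨y i, by simp [hg, mul_div_cancel₀ _ hn0]⟩
  have hrange : ∀ v, v ∈ (n : ℝ)⁻¹ •
      ((Submodule.span ℤ (Set.range (Pi.basisFun ℝ (Fin 3))) : Submodule ℤ (Fin 3 → ℝ)) :
        Set (Fin 3 → ℝ)) → v ∈ Set.range g := by
    intro v hv
    rw [← Submodule.coe_pointwise_smul, SetLike.mem_coe,
      BoxIntegral.unitPartition.mem_smul_span_iff] at hv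
    choose y hy using hv
    refine ⟨y, funext fun j => ?_⟩
    have := hy j
    simp only [eq_intCast] at this
    simp only [hg]
    rw [this, mul_div_cancel_left₀ _ hn0]
  calc ∑' x, (s ∩ _).indicator F x = ∑' y, (s ∩ _).indicator F (g y) :=
        (hginj.tsum_eq fun v hv => hrange v (Set.support_indicator_subset hv).2).symm
    _ = ∑' y, F (g y) := tsum_congr fun y => ?_
  by_cases hys : g y ∈ s
  · exact Set.indicator_of_mem (Set.mem_inter hys (hgmem y)) F
  · rw [Set.indicator_of_notMem (fun h => hys h.1), hsupp _ hys]

/-- **Registered helper sub-goal `stub_pointwiseUpgrade_auxRiemann`** of stub `stub_pointwiseUpgrade`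
(line `self-energy-pick-inversion`, crux stmt-CriticalPhenomena-4799): the lattice Riemann-sum lemma
`n⁻³ ∑_{y ∈ ℤ³} F (y / n) → ∫ F` for `F : ℝ³ → ℝ` continuous with compact support. [folklore] -/
theorem stub_pointwiseUpgrade_auxRiemann :
    ∀ (F : (Fin 3 → ℝ) → ℝ), Continuous F → HasCompactSupport F → Filter.Tendsto (fun n : ℕ => (∑' y
      : Site 3, F (fun j => (y j : ℝ) / (n : ℝ))) / (n : ℝ) ^ 3) Filter.atTop (nhds (∫ v, F v)) :=
  fun F hF hFc => tendsto_lattice_sum_div_cube F hF hFc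

end Summit.CriticalPhenomena.Ising3DConformalLimit.Cruxes.DirectCorrelationStableTail.SelfEnergyPickInversion

end
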